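import Summits.NavierStokesRegularity.NavierStokesRegularity.Theorems.MustSqueeze.Negative.WithoutOseen

/-!
# Crux `MustSqueeze` (stmt-NavierStokesRegularity-11610), negative side: constants are KNSS-mild

Negative-side (cdisprove, D-0016) support lemmas extracted from `Cruxes/MustSqueeze/Disproof.lean` v7:
`isKNSSMild_const` — every CONSTANT field satisfies the typed KNSS/Oseen mild clause H3 (the
written-out kernel is odd in `x − y`, so its Bochner integral vanishes by reflection and translation
invariance alone; `e^{σΔ}c = c`), and `mustSqueeze_false_without_H4H5` — the crux with BOTH
normalisation clauses H4 (Type-I rate) and H5 (scaled energies) deleted is FALSE (witness `u ≡ e₀`).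
Any proof of the crux must use H4 or H5.  No route statement is changed (`--supports`).
-/

noncomputable section

namespace Summit.NavierStokesRegularity.NavierStokesRegularity.Theorems.MustSqueeze.Negative

open MeasureTheory Set Filter Topology
open Literature.Analysis.FluidPDE Literature.Analysis.UnboundedOperators

/-! ## Constants are KNSS-mild; the crux without H4 ∧ H5 is false -/

/-- The written-out Oseen integrand of H3 evaluated on a CONSTANT field `u ≡ c`, as a function of
`z = x − y`. -/
def constKernel (c : (EuclideanSpace ℝ (Fin 3))) (t τ : ℝ) (z : (EuclideanSpace ℝ (Fin 3))) : (EuclideanSpace ℝ (Fin 3)) :=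
  ((-(inner ℝ z c / (2*(t-τ)) * heatKernel (t-τ) z)) • c +
    (∫ σ in Set.Ioi (t-τ), heatKernel σ z / (4*σ^2)) • (inner ℝ z c • c + inner ℝ c c • z + inner ℝ z c • c) -
    ((∫ σ in Set.Ioi (t-τ), heatKernel σ z / (8*σ^3)) * (inner ℝ z c * inner ℝ z c)) • z)

/-- On a constant field the Oseen integrand is `constKernel` of `x − y`. -/
theorem oseenIntegrand_const (c : (EuclideanSpace ℝ (Fin 3))) (t τ : ℝ) (x y : (EuclideanSpace ℝ (Fin 3))) :
    oseenIntegrand (fun _ _ => c) t τ x y = constKernel c t τ (x - y) := rfl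

/-- The Gauss–Weierstrass kernel is even. -/
theorem heatKernel_neg (σ : ℝ) (z : (EuclideanSpace ℝ (Fin 3))) : heatKernel σ (-z) = heatKernel σ z := by
  simp [heatKernel, norm_neg]

/-- The constant-field Oseen integrand is ODD in `z = x − y` (every term carries an odd number of
factors `z`, the kernel factors being even). -/
theorem constKernel_neg (c : (EuclideanSpace ℝ (Fin 3))) (t τ : ℝ) (z : (EuclideanSpace ℝ (Fin 3))) :
    constKernel c t τ (-z) = -constKernel c t τ z := by
  simp only [constKernel, heatKernel_neg, inner_neg_left, neg_div, neg_neg, neg_mul, mul_neg,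
    neg_smul, smul_neg]
  module

/-- Hence its space integral vanishes — by reflection and translation invariance of Lebesgue
measure alone: NO integrability input is needed (both invariances hold for the Bochner integral of
an arbitrary integrand). -/
theorem integral_oseenIntegrand_const (c : (EuclideanSpace ℝ (Fin 3))) (t τ : ℝ) (x : (EuclideanSpace ℝ (Fin 3))) :
    ∫ y, oseenIntegrand (fun _ _ => c) t τ x y = 0 := by
  simp only [oseenIntegrand_const]
  rw [integral_sub_left_eq_self (constKernel c t τ) volume x]
  have h := integral_neg_eq_self (constKernel c t τ) volume
  simp only [constKernel_neg, integral_neg] at h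
  have h2 : (2 : ℝ) • ∫ a, constKernel c t τ a = 0 := by
    rw [two_smul]
    nth_rw 1 [← h]
    exact neg_add_cancel _
  exact (smul_eq_zero.1 h2).resolve_left two_ne_zero

/-- `e^{τΔ} c = c` for a constant (`∫ heatKernel = 1`; for `τ ≤ 0` by the junk convention). -/
theorem heatFlow_const (c : (EuclideanSpace ℝ (Fin 3))) (τ : ℝ) :
    Literature.Analysis.FluidPDE.heatFlow (fun _ : (EuclideanSpace ℝ (Fin 3)) => c) τ = fun _ => c := by
  by_cases hτ : 0 < τ
  · rw [heatFlow_of_pos _ hτ]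
    funext x
    rw [heatExtension_apply, integral_smul_const, integral_heatKernel_eq_one_holds hτ, one_smul]
  · exact heatFlow_of_nonpos _ (not_lt.1 hτ)

/-- **Constants are KNSS-mild.** Every constant field satisfies the typed Oseen clause H3. -/
theorem isKNSSMild_const (c : (EuclideanSpace ℝ (Fin 3))) : H3 (fun _ _ => c) := by
  intro s t _ _ x
  rw [heatFlow_const]
  simp [integral_oseenIntegrand_const]

/-- Constants are smooth, divergence free and squeezed (`Λ ≡ 0`). -/
theorem h1_h2_h6_const (c : (EuclideanSpace ℝ (Fin 3))) : H1 (fun _ _ => c) ∧ H2 (fun _ _ => c) ∧ H6 (1 / 8) (fun _ _ => c) := by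
  refine ⟨contDiffOn_const, ?_, ?_⟩
  · intro t _ x
    simp [VectorCalculus.divergence]
  · exact h6_of_fderiv_eq_zero (by norm_num) fun t _ x => by simp

/-- The crux with BOTH normalisation clauses H4 (Type-I rate) and H5 (scaled energies) deleted. -/
def MustSqueezeWithoutH4H5 : Prop :=
  ∀ u : ℝ → (EuclideanSpace ℝ (Fin 3)) → (EuclideanSpace ℝ (Fin 3)), H1 u ∧ H2 u ∧ H3 u → H6 (1 / 8) u → VanishesOnPast u

/-- **Any proof must use H4 or H5**: without them the nonzero constant `u ≡ e₀` is a smooth,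
divergence-free, KNSS-mild, everywhere-squeezed field.  (Constants fail H4 as `t → −∞` and fail
H5 for large `r`; dropping only ONE of H4/H5 leaves a statement of open-problem strength — a
nonzero witness would be a genuine ancient mild solution, cf. `whyItResists`.) -/
theorem mustSqueeze_false_without_H4H5 : ¬ MustSqueezeWithoutH4H5 := by
  intro h
  have h0 : (EuclideanSpace.single 0 1 : (EuclideanSpace ℝ (Fin 3))) = 0 :=
    h (fun _ _ => EuclideanSpace.single 0 1) ⟨(h1_h2_h6_const _).1, (h1_h2_h6_const _).2.1,
      isKNSSMild_const _⟩ (h1_h2_h6_const _).2.2 (-1) (by norm_num) 0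
  have h1 : ‖(EuclideanSpace.single 0 1 : (EuclideanSpace ℝ (Fin 3)))‖ = 1 := by simp
  rw [h0, norm_zero] at h1
  exact zero_ne_one h1



end Summit.NavierStokesRegularity.NavierStokesRegularity.Theorems.MustSqueeze.Negative
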